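import Summits.ResolutionOfSingularities.ResolutionOfSingularities.Theorems.WeightedInvariantIota3RowABeta
import Literature.RingTheory.MvPowerSeries.MaximalIdealPow

/-!
# (F-3e) ROW A DOMINANCE FOR ALL COMPETING FLAGS  [OURS · L1 W4.3]

Kernel infrastructure for RE-ENTRY OBJECT #1 of chain w43 (door crux `stmt-ResolutionOfSingularities-19897`),
rung (F-3e) of res-D-brk-1's Frobenius-class argument (O70B-JCAN-PLAN §7 with §5 (R2)/(R3)): the second-member
dominance of ROW A holds against EVERY competing two-flag — no common transversal parameter, no swap-corner
case distinction:

* `rowA_core_anyFrame` / `rowA_secondMember_mem_anyFrame` — `RowA.rowA_core` for the germ `y^p + Λ v^d + x^M`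
  written in an ARBITRARY regular system of parameters `(x, v, y)` of `K⟦X₀,X₁,X₂⟧` (against the coordinate flag):
  `W(x^M) ≥ N` for every `x ∈ 𝔪`; in case (β) both `v` and `y` lose their `X₀`- and `X₁`-terms, which no frame
  allows (`RowA.false_of_frame₂`);
* `exists_isUnit_det_of_isTwoFlag` — a two-flag `(y'; v')` is completed to a frame `(X_i, v', y')` by SOME
  coordinate;
* **`rowA_secondMember_mem_of_isTwoFlag`** — for every two-flag `(y'; v')`:
  `X₂^p + Λ X₁^d + X₀^M ∈ F_{(y';v')}^{(q;r₁,r₂)}(N) ⇒ X₁ ∈ F_{(y';v')}^{(q;r₁,r₂)}(r₂)`.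

[OURS · L1 W4.3] NOT a statement of the manuscript; AI-produced, gate-checked, weaker than expert review.
-/

set_option linter.dupNamespace false

namespace Summit.ResolutionOfSingularities.ResolutionOfSingularities.Theorems.LocalEngine.Iota3.RowA

open MvPowerSeries IsLocalRing
open Summit.ResolutionOfSingularities.ResolutionOfSingularities.Theorems.LocalEngine.Iota3.PClass
open Summit.ResolutionOfSingularities.ResolutionOfSingularities.Cruxes.HypersurfaceCentreConstruction.LocalEngine.Iota3
open Literature.AlgebraicGeometry.Resolution.FormalCoordChange

variable {K : Type*} [Field K]

/-! ## Row A in an arbitrary frame -/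

/-- **ROW A, CORE FORM, ARBITRARY FRAME**: for `f = y^p + Λ v^d + x^M` with `x, v, y ∈ 𝔪` and
`X₀, X₁ ∈ (x, v, y)`, `W(f) ≥ N` forces `W(v) ≥ r₂` (weights `(q, r₂, r₁)`). -/
theorem rowA_core_anyFrame (p : ℕ) [Fact p.Prime] [CharP K p] {d M q r₁ r₂ N : ℕ} (hpd : ¬ p ∣ d) (hlt : p < d)
    (hN₁ : p * r₁ = N) (hN₂ : d * r₂ = N) (hN₃ : M * q = N) (hq : 0 < q) (hqr : q < r₂) {Λ : K} (hΛ : Λ ≠ 0)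
    {x y v : MvPowerSeries (Fin 3) K} (hx0 : constantCoeff x = 0) (hv0 : constantCoeff v = 0)
    (hy0 : constantCoeff y = 0)
    (hX0 : (X 0 : MvPowerSeries (Fin 3) K) ∈ Ideal.span {x, v, y})
    (hX1 : (X 1 : MvPowerSeries (Fin 3) K) ∈ Ideal.span {x, v, y})
    (hreach : (N : ℕ∞) ≤ (y ^ p + C Λ * v ^ d + x ^ M).weightedOrder ![q, r₂, r₁]) :
    (r₂ : ℕ∞) ≤ v.weightedOrder ![q, r₂, r₁] := by
  classical
  -- numerics
  have hp : p.Prime := Fact.out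
  have hp2 : 2 ≤ p := hp.two_le
  have hd2 : 2 ≤ d := by omega
  have hr₂ : 0 < r₂ := by omega
  have hr₂r₁ : r₂ < r₁ := by
    by_contra h
    push Not at h
    have h1 : p * r₁ ≤ p * r₂ := Nat.mul_le_mul_left _ h
    have h2 : p * r₂ < d * r₂ := Nat.mul_lt_mul_of_pos_right hlt hr₂
    omega
  have hpr₂N : p * r₂ < N := by
    have := Nat.mul_lt_mul_of_pos_left hr₂r₁ hp.pos
    omega
  have hpM : p < M := by
    by_contra h
    push Not at h
    have h1 : M * q ≤ p * q := Nat.mul_le_mul_right _ h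
    have h2 : p * q < p * r₁ := Nat.mul_lt_mul_of_pos_left (hqr.trans hr₂r₁) hp.pos
    omega
  have hpqN : p * q < N := by
    have := Nat.mul_lt_mul_of_pos_right hpM hq
    omega
  haveI : NeZero p := ⟨hp.ne_zero⟩
  haveI : Fact (1 < p) := ⟨hp.one_lt⟩
  -- `x^M` and `h = y^p + Λ v^d` weigh at least `N`
  have hWxM : (N : ℕ∞) ≤ (x ^ M).weightedOrder ![q, r₂, r₁] :=
    le_weightedOrder_pow_of_constantCoeff_eq_zero hqr.le hr₂r₁.le hN₃ hx0
  have hWh : (N : ℕ∞) ≤ (y ^ p + C Λ * v ^ d).weightedOrder ![q, r₂, r₁] := by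
    have hX : (N : ℕ∞) ≤ (-(x ^ M)).weightedOrder ![q, r₂, r₁] := by rwa [weightedOrder_neg]
    have h := min_weightedOrder_le_add (w := ![q, r₂, r₁]) (f := y ^ p + C Λ * v ^ d + x ^ M) (g := -(x ^ M))
    rw [add_neg_cancel_right] at h
    exact le_trans (le_min hreach hX) h
  by_contra hvlt
  push Not at hvlt
  -- the initial form of `v` is `μ X₀^{m₀}`, `q m₀ < r₂`
  obtain ⟨m₀, hcm, hWv, ham, hini⟩ := initialMonomial_of_weightedOrder_lt hq hr₂r₁.le hvlt
  have hm₀ : 0 < m₀ := by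
    by_contra h0
    have h0 : m₀ = 0 := by omega
    rw [h0, Finsupp.single_zero, coeff_zero_eq_constantCoeff_apply, hv0] at hcm
    exact hcm rfl
  -- `y` has neither `X₀`- nor `X₁`-term
  have hy₀ : coeff (Finsupp.single 0 1) y = 0 :=
    coeff_linear_eq_zero_of_reach p hlt hpM _ 0 (show p * q < N from hpqN) hv0 hx0 hreach
  have hy₁ : coeff (Finsupp.single 1 1) y = 0 :=
    coeff_linear_eq_zero_of_reach p hlt hpM _ 1 (show p * r₂ < N from hpr₂N) hv0 hx0 hreach
  by_cases hpm : p ∣ m₀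
  · /- CASE (β): `W(v − v_0) > r₂ > q`, and `v_0` has no exponent of nonzero class. -/
    have hR := r₂_lt_weightedOrder_rest p hpd hd2 hN₂ hqr hΛ hcm hini ham hpm hWh
    have hR₁ : coeff (Finsupp.single 1 1) (v - pClassComponent p 0 v) = 0 :=
      coeff_eq_zero_of_lt_weightedOrder (![q, r₂, r₁]) (by rwa [weight_single_one])
    have hR₀ : coeff (Finsupp.single 0 1) (v - pClassComponent p 0 v) = 0 := by
      refine coeff_eq_zero_of_lt_weightedOrder (![q, r₂, r₁]) (lt_trans ?_ hR)
      rw [weight_single_zero, mul_one, Nat.cast_lt]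
      exact hqr
    have hcl : ∀ i : Fin 3, exponentClass p (Finsupp.single i 1) ≠ 0 := fun i h => by
      have h1 := congr_fun h i
      rw [exponentClass_apply, Finsupp.single_eq_same, Nat.cast_one, Pi.zero_apply] at h1
      exact one_ne_zero h1
    have hG₀ : coeff (Finsupp.single 0 1) (pClassComponent p 0 v) = 0 := coeff_pClassComponent_of_ne (hcl 0) v
    have hG₁ : coeff (Finsupp.single 1 1) (pClassComponent p 0 v) = 0 := coeff_pClassComponent_of_ne (hcl 1) v
    have hsplit : v = (v - pClassComponent p 0 v) + pClassComponent p 0 v := (sub_add_cancel v _).symm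
    have hv₀ : coeff (Finsupp.single 0 1) v = 0 := by rw [hsplit, map_add, hR₀, hG₀, add_zero]
    have hv₁ : coeff (Finsupp.single 1 1) v = 0 := by rw [hsplit, map_add, hR₁, hG₁, add_zero]
    exact false_of_frame₂ hX0 hX1 hx0 hv0 hy0 hv₀ hv₁ hy₀ hy₁
  · /- CASE (α): the coefficient of `X₀^{d m₀}` in `f` is `Λ μ^d ≠ 0`, of weight `d q m₀ < N`. -/
    have hdm : ¬ p ∣ d * m₀ := fun h => (hp.dvd_mul.mp h).elim hpd hpm
    have hwt : Finsupp.weight ![q, r₂, r₁] (Finsupp.single 0 (d * m₀)) < N := by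
      rw [weight_single_zero, ← hN₂]
      nlinarith
    have hz : coeff (Finsupp.single 0 (d * m₀)) (y ^ p + C Λ * v ^ d + x ^ M) = 0 :=
      coeff_eq_zero_of_lt_weightedOrder _ (lt_of_lt_of_le (by exact_mod_cast hwt) hreach)
    rw [map_add, map_add, coeff_pow_expChar_eq_zero p y (i := 0) (by rwa [Finsupp.single_eq_same]), zero_add,
      coeff_C_mul, coeff_eq_zero_of_lt_weightedOrder _ (lt_of_lt_of_le (by exact_mod_cast hwt) hWxM),
      add_zero] at hz
    exact (mul_ne_zero hΛ (coeff_single_pow_ne_zero hcm hini (by omega))) hz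

/-- **ROW A IN AN ARBITRARY FRAME**: for any regular system of parameters `(x, v, y)` of `K⟦X₀,X₁,X₂⟧`,
`y^p + Λ v^d + x^M ∈ F_{(X₂;X₁)}(N) ⇒ v ∈ F_{(X₂;X₁)}(r₂)`. -/
theorem rowA_secondMember_mem_anyFrame (p : ℕ) [Fact p.Prime] [CharP K p] (d M q r₁ r₂ N : ℕ)
    (hpd : ¬ p ∣ d) (hlt : p < d) (hN₁ : p * r₁ = N) (hN₂ : d * r₂ = N) (hN₃ : M * q = N) (hq : 0 < q)
    (hqr : q < r₂) (Λ : K) (hΛ : Λ ≠ 0) (x y v : MvPowerSeries (Fin 3) K)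
    (hframe : Ideal.span {x, v, y} = maximalIdeal (MvPowerSeries (Fin 3) K))
    (hreach : y ^ p + C Λ * v ^ d + x ^ M ∈ flagContactFiltration (X 2 : MvPowerSeries (Fin 3) K) (X 1) q r₁ r₂ N) :
    v ∈ flagContactFiltration (X 2 : MvPowerSeries (Fin 3) K) (X 1) q r₁ r₂ r₂ := by
  have hp : p.Prime := Fact.out
  have hr₂ : 0 < r₂ := by omega
  have hr₂r₁ : r₂ ≤ r₁ := by
    by_contra h
    push Not at h
    have h1 : p * r₁ < p * r₂ := Nat.mul_lt_mul_of_pos_left h hp.pos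
    have h2 : p * r₂ < d * r₂ := Nat.mul_lt_mul_of_pos_right hlt hr₂
    omega
  have hadm : AdmissibleTriple q r₁ r₂ := ⟨hq, hqr.le, hr₂r₁⟩
  have hmem : ∀ g ∈ ({x, v, y} : Set (MvPowerSeries (Fin 3) K)), constantCoeff g = 0 := fun g hg =>
    constantCoeff_eq_zero_of_mem_maximalIdeal (hframe ▸ Ideal.subset_span hg)
  have hXi : ∀ i : Fin 3, (X i : MvPowerSeries (Fin 3) K) ∈ Ideal.span {x, v, y} := fun i =>
    hframe ▸ mem_maximalIdeal_of_constantCoeff_eq_zero (constantCoeff_X i)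
  rw [mem_flagContactFiltration_X_iff hadm] at hreach ⊢
  exact rowA_core_anyFrame p hpd hlt hN₁ hN₂ hN₃ hq hqr hΛ (hmem x (by simp)) (hmem v (by simp)) (hmem y (by simp))
    (hXi 0) (hXi 1) hreach

/-! ## Completing a two-flag to a frame -/

/-- Exponents of degree `< 2` in three variables: `0` or some `e_j`. -/
theorem eq_zero_or_eq_single_of_degree_lt_two (e : Fin 3 →₀ ℕ) (he : e.degree < 2) :
    e = 0 ∨ ∃ j : Fin 3, e = Finsupp.single j 1 := by
  rw [Finsupp.degree_eq_sum, Fin.sum_univ_three] at he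
  have key : ∀ a b c : ℕ, e 0 = a → e 1 = b → e 2 = c → e = Finsupp.single 0 a + Finsupp.single 1 b + Finsupp.single 2 c := by
    rintro a b c rfl rfl rfl
    ext i; fin_cases i <;> simp
  rcases Nat.lt_or_ge (e 0 + e 1 + e 2) 1 with h | h
  · left
    rw [key 0 0 0 (by omega) (by omega) (by omega)]; simp
  · right
    rcases Nat.eq_zero_or_pos (e 0) with h0 | h0
    · rcases Nat.eq_zero_or_pos (e 1) with h1 | h1
      · exact ⟨2, by rw [key 0 0 1 h0 h1 (by omega)]; simp⟩
      · exact ⟨1, by rw [key 0 1 0 h0 (by omega) (by omega)]; simp⟩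
    · exact ⟨0, by rw [key 1 0 0 (by omega) (by omega) (by omega)]; simp⟩

/-- A series without constant and linear terms lies in `𝔪²`. -/
theorem mem_maximalIdeal_sq_of_coeff_eq_zero {g : MvPowerSeries (Fin 3) K} (h0 : constantCoeff g = 0)
    (h1 : ∀ j : Fin 3, coeff (Finsupp.single j 1) g = 0) : g ∈ maximalIdeal (MvPowerSeries (Fin 3) K) ^ 2 := by
  refine Literature.RingTheory.MvPowerSeries.Jets.mem_maximalIdeal_pow_of_coeff_eq_zero fun e he => ?_
  rcases eq_zero_or_eq_single_of_degree_lt_two e he with rfl | ⟨j, rfl⟩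
  · rwa [coeff_zero_eq_constantCoeff_apply]
  · exact h1 j

/-- **A TWO-FLAG IS COMPLETED TO A FRAME BY SOME COORDINATE**: if `(y'; v')` is a two-flag of `K⟦X₀,X₁,X₂⟧` then
for some `i` the substitution family `(X_i, v', y')` has invertible linear part. -/
theorem exists_isUnit_det_of_isTwoFlag {y' v' : MvPowerSeries (Fin 3) K} (hflag : IsTwoFlag y' v') :
    ∃ i : Fin 3, IsUnit (linMat ![(X i : MvPowerSeries (Fin 3) K), v', y']).det := by
  classical
  -- linear parts
  set a : Fin 3 → K := fun j => coeff (Finsupp.single j 1) v' with ha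
  set b : Fin 3 → K := fun j => coeff (Finsupp.single j 1) y' with hb
  have hv0 : constantCoeff v' = 0 := constantCoeff_eq_zero_of_mem_maximalIdeal hflag.2.1
  have hy0 : constantCoeff y' = 0 := constantCoeff_eq_zero_of_mem_maximalIdeal hflag.1
  -- the three determinants are the `2 × 2` minors of `(a, b)`
  have hentry : ∀ i j : Fin 3, linMat ![(X i : MvPowerSeries (Fin 3) K), v', y'] 0 j = if j = i then 1 else 0 :=
    fun i j => by simp only [linMat, Matrix.of_apply, Matrix.cons_val_zero, coeff_index_single_X]
  have hentry1 : ∀ i j : Fin 3, linMat ![(X i : MvPowerSeries (Fin 3) K), v', y'] 1 j = a j := fun i j => rfl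
  have hentry2 : ∀ i j : Fin 3, linMat ![(X i : MvPowerSeries (Fin 3) K), v', y'] 2 j = b j := fun i j => rfl
  have hdet : ∀ i : Fin 3, (linMat ![(X i : MvPowerSeries (Fin 3) K), v', y']).det =
      (if (0 : Fin 3) = i then 1 else 0) * (a 1 * b 2 - a 2 * b 1) -
        (if (1 : Fin 3) = i then 1 else 0) * (a 0 * b 2 - a 2 * b 0) +
        (if (2 : Fin 3) = i then 1 else 0) * (a 0 * b 1 - a 1 * b 0) := by
    intro i
    rw [Matrix.det_fin_three]
    simp only [hentry, hentry1, hentry2]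
    ring
  -- suppose all three minors vanish
  by_contra hnone
  push Not at hnone
  have hz : ∀ i : Fin 3, (linMat ![(X i : MvPowerSeries (Fin 3) K), v', y']).det = 0 := fun i =>
    not_not.mp fun h => hnone i (isUnit_iff_ne_zero.mpr h)
  have m0 := hz 0; have m1 := hz 1; have m2 := hz 2
  rw [hdet] at m0 m1 m2
  simp only [if_true, show ((1 : Fin 3) = 0) = False from by simp, show ((2 : Fin 3) = 0) = False from by simp,
    show ((0 : Fin 3) = 1) = False from by simp, show ((2 : Fin 3) = 1) = False from by simp,
    show ((0 : Fin 3) = 2) = False from by simp, show ((1 : Fin 3) = 2) = False from by simp,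
    if_false, one_mul, zero_mul, sub_zero, zero_sub, add_zero, zero_add, neg_eq_zero] at m0 m1 m2
  -- `a j · b − b j · a = 0` componentwise
  have key : ∀ j k : Fin 3, a j * b k - b j * a k = 0 := by
    intro j k
    fin_cases j <;> fin_cases k
    · show a 0 * b 0 - b 0 * a 0 = 0
      ring
    · show a 0 * b 1 - b 0 * a 1 = 0
      linear_combination m2
    · show a 0 * b 2 - b 0 * a 2 = 0
      linear_combination m1
    · show a 1 * b 0 - b 1 * a 0 = 0
      linear_combination (-1 : K) * m2
    · show a 1 * b 1 - b 1 * a 1 = 0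
      ring
    · show a 1 * b 2 - b 1 * a 2 = 0
      linear_combination m0
    · show a 2 * b 0 - b 2 * a 0 = 0
      linear_combination (-1 : K) * m1
    · show a 2 * b 1 - b 2 * a 1 = 0
      linear_combination (-1 : K) * m0
    · show a 2 * b 2 - b 2 * a 2 = 0
      ring
  -- a linear combination with zero linear part lies in `𝔪²`; the two-flag property then forces constants to vanish
  have hsq : ∀ c c' : K, (∀ k, c * b k + c' * a k = 0) →
      C c * y' + C c' * v' ∈ maximalIdeal (MvPowerSeries (Fin 3) K) ^ 2 := by
    intro c c' hk
    refine mem_maximalIdeal_sq_of_coeff_eq_zero (by rw [map_add, map_mul, map_mul, hy0, hv0, mul_zero, mul_zero, add_zero])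
      fun k => ?_
    rw [map_add, coeff_C_mul, coeff_C_mul]
    exact hk k
  have hconst : ∀ c : K, (C c : MvPowerSeries (Fin 3) K) ∈ maximalIdeal (MvPowerSeries (Fin 3) K) → c = 0 :=
    fun c hc => by simpa using constantCoeff_eq_zero_of_mem_maximalIdeal hc
  by_cases hA : ∀ j, a j = 0
  · -- `v'` has no linear part: `v' ∈ 𝔪²`, contradicting the two-flag property (`0·y' + 1·v'`)
    have h := hsq 0 1 (fun k => by rw [hA k, zero_mul, mul_zero, add_zero])
    rw [map_zero, zero_mul, zero_add, map_one, one_mul] at h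
    have h1 := (hflag.2.2 0 1 (by rwa [zero_mul, one_mul, zero_add])).2
    exact (IsLocalRing.maximalIdeal.isMaximal _).ne_top (Ideal.eq_top_of_isUnit_mem _ h1 isUnit_one)
  · push Not at hA
    obtain ⟨j, hj⟩ := hA
    have h := hsq (a j) (-b j) (fun k => by linear_combination key j k)
    have h1 := (hflag.2.2 (C (a j)) (C (-b j)) h).1
    exact hj (hconst _ h1)

/-! ## Row A against every competing two-flag -/

/-- `𝔪 = (X₀, X₁, X₂)` as a span of three elements. -/
theorem maximalIdeal_eq_span_triple :
    maximalIdeal (MvPowerSeries (Fin 3) K) =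
      Ideal.span {(X 0 : MvPowerSeries (Fin 3) K), X 1, X 2} := by
  classical
  apply le_antisymm
  · rw [maximalIdeal_eq_span_X, Ideal.span_le]
    rintro _ ⟨i, rfl⟩
    fin_cases i
    · exact Ideal.subset_span (by simp)
    · exact Ideal.subset_span (by simp)
    · exact Ideal.subset_span (by simp)
  · rw [Ideal.span_le]
    rintro g (rfl | rfl | rfl) <;> exact mem_maximalIdeal_of_constantCoeff_eq_zero (constantCoeff_X _)

/-- **ROW A DOMINANCE FOR EVERY COMPETING FLAG** [OURS · L1 W4.3 · (F-3e)].  For a field `K` of characteristic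
`p` and the germ `f = X₂^p + Λ X₁^d + X₀^M ∈ K⟦X₀,X₁,X₂⟧` (`p ∤ d`, `p < d`, `Λ ≠ 0`, `N = p r₁ = d r₂ = M q`,
`0 < q < r₂`): EVERY two-flag `(y'; v')` carrying `f` to level `N` of its `(q; r₁, r₂)`-filtration weighs `X₁` at
least `r₂/q` — `X₁ ∈ F_{(y';v')}(r₂)`.  (No frame hypothesis: the swap corner is included.) -/
theorem rowA_secondMember_mem_of_isTwoFlag (p : ℕ) [Fact p.Prime] {K : Type*} [Field K] [CharP K p]
    (d M q r₁ r₂ N : ℕ) (hpd : ¬ p ∣ d) (hlt : p < d) (hN₁ : p * r₁ = N) (hN₂ : d * r₂ = N) (hN₃ : M * q = N)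
    (hq : 0 < q) (hqr : q < r₂) (Λ : K) (hΛ : Λ ≠ 0) (y' v' : MvPowerSeries (Fin 3) K) (hflag : IsTwoFlag y' v')
    (hreach : (X 2 : MvPowerSeries (Fin 3) K) ^ p + C Λ * X 1 ^ d + X 0 ^ M ∈ flagContactFiltration y' v' q r₁ r₂ N) :
    (X 1 : MvPowerSeries (Fin 3) K) ∈ flagContactFiltration y' v' q r₁ r₂ r₂ := by
  obtain ⟨i, hdet⟩ := exists_isUnit_det_of_isTwoFlag hflag
  set θ : Fin 3 → MvPowerSeries (Fin 3) K := ![(X i : MvPowerSeries (Fin 3) K), v', y'] with hθ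
  have hv0 : constantCoeff v' = 0 := constantCoeff_eq_zero_of_mem_maximalIdeal hflag.2.1
  have hy0 : constantCoeff y' = 0 := constantCoeff_eq_zero_of_mem_maximalIdeal hflag.1
  have h0 : ∀ j, constantCoeff (θ j) = 0 := by
    intro j; fin_cases j
    · exact constantCoeff_X i
    · exact hv0
    · exact hy0
  have hθs : HasSubst θ := hasSubst_of_constantCoeff_zero h0
  obtain ⟨e, he⟩ := exists_ringEquiv_subst h0 hdet
  have he1 : e (X 1) = v' := by rw [he, subst_X hθs]; rfl
  have he2 : e (X 2) = y' := by rw [he, subst_X hθs]; rfl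
  have heC : e (C Λ) = C Λ := by rw [he, subst_C]
  set ψ := e.symm with hψ
  have hψv : ψ v' = X 1 := by rw [hψ, RingEquiv.symm_apply_eq, he1]
  have hψy : ψ y' = X 2 := by rw [hψ, RingEquiv.symm_apply_eq, he2]
  have hψC : ψ (C Λ) = C Λ := by rw [hψ, RingEquiv.symm_apply_eq, heC]
  -- the germ in the frame `(ψ X₀, ψ X₁, ψ X₂)` against the coordinate flag
  have hreach' : (ψ (X 2)) ^ p + C Λ * (ψ (X 1)) ^ d + (ψ (X 0)) ^ M ∈
      flagContactFiltration (X 2 : MvPowerSeries (Fin 3) K) (X 1) q r₁ r₂ N := by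
    have h := (apply_mem_flagContactFiltration_iff ψ ((X 2 : MvPowerSeries (Fin 3) K) ^ p + C Λ * X 1 ^ d + X 0 ^ M)
      y' v' q r₁ r₂ N).mpr hreach
    rwa [hψy, hψv, map_add, map_add, map_pow, map_mul, map_pow, map_pow, hψC] at h
  have hframe' : Ideal.span {ψ (X 0), ψ (X 1), ψ (X 2)} = maximalIdeal (MvPowerSeries (Fin 3) K) := by
    rw [← map_ringEquiv_maximalIdeal ψ, maximalIdeal_eq_span_triple, Ideal.map_span, Set.image_insert_eq,
      Set.image_insert_eq, Set.image_singleton]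
  have h := rowA_secondMember_mem_anyFrame p d M q r₁ r₂ N hpd hlt hN₁ hN₂ hN₃ hq hqr Λ hΛ (ψ (X 0)) (ψ (X 2)) (ψ (X 1))
    hframe' hreach'
  have h' := apply_mem_flagContactFiltration_iff ψ (X 1 : MvPowerSeries (Fin 3) K) y' v' q r₁ r₂ r₂
  rw [hψy, hψv] at h'
  exact h'.mp h

end Summit.ResolutionOfSingularities.ResolutionOfSingularities.Theorems.LocalEngine.Iota3.RowA
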